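/-
Copyright (c) 2026 the pub-hodgecm-mathlib formalisation cell (harness21).  Prover seat hodgecm-mathlib-K2E3-p25 (g2), HCML Track B «K2-LIT»,
h413 = `stmt-HodgeConjecture-24833`, road (11-3-split-nsc), leaf (nsc-S-A′), brick (E4b-1γ, part 2b = the cell INTEGRAND) of the weak cell lemma (dealer D105′).
2026-09-04.
-/
import Summits.HodgeConjecture.HodgeConjecture.Theorems.K2E3GL3BorelInducedJacquetQOpenCellSupport   -- ★ part 1: `exists_transvections_fix`, `toFun_eq_zero_of_entry_large`
import Summits.HodgeConjecture.HodgeConjecture.Theorems.K2E3GL3BorelInducedJacquetQOpenCellAlgebra   -- ★ part 2a: `uP_*`, `cellPoint_apply`, `minor_cellPoint`, `uP_mul_diag`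
import Literature.NumberTheory.Weil1964.LocalLinearChangeOfVariables                                  -- ★ `integral_comp_linearEquiv`
import HarnessLib

/-!
# K2_E3 road (h413), leaf (nsc-S-A′), brick E4b-1γ part 2b — the cell integrand `v ↦ f(w·n(v)·ι̂(g))` on `U_P ≅ F²`: continuity, compact support,
# integrability, translation and the `|det|` substitution

Cell `pub/hodgecm-mathlib` (D-0151), Track B, seat K2E3-p25 (g2).  `--supports stmt-HodgeConjecture-24833 --as helper`; THEOREMS ONLY (no `def`, no instance, no notation,
no `sorry`); never imports `Cruxes/…/Lines`.  COUNT-NEUTRAL.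

THE MATHEMATICS ([BernsteinZelevinsky1977, §5, Thm. 5.2 (open orbit)]; [WeilBNT1967, Chap. I §2 (module of an automorphism)]).  For `f ∈ Ind_B^G σ′` smooth, the function
`f` is locally constant on `G = GL₃(F)` (`continuous_toFun`); for `f` vanishing on `Z = {m = 0}` the cell integrand `φ_{f,g}(v) = f(w·n(v)·ι̂(g))` on `F²` is continuous with
COMPACT support (★ part 1 support lemma + ★ part 2a `cellPoint_apply`∕`minor_cellPoint`: support `⊆ {max(|v₀|,|v₁|) ≤ ‖g‖∕ε}`), hence integrable for the product Haar
measure `μ ⊗ μ` (`integrable_cellFn`).  Two identities of integrals: TRANSLATION `∫ f(w·n(v)·ι̂(g)·u) dv = ∫ f(w·n(v)·ι̂(g)) dv` for `u ∈ U_P` (`u = n(a,b)`, `ι̂(g)·n(a,b) =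
n(g(a,b))·ι̂(g)`, invariance of `μ ⊗ μ`), and SUBSTITUTION `∫ f(w·n(v)·ι̂(b)·x) dv = |det b| · ∫ f(w·ι̂(b)·n(v)·x) dv` (`n(v)·ι̂(b) = ι̂(b)·n(b⁻¹v)`, ★ Weil's
`∫ φ(e v) = |det e|⁻¹ ∫ φ` for `e = b⁻¹`).  Part 2c builds the `U_P`-invariant, `GL₂`-equivariant cell map `J_Z → Ind_{B₂}^{GL₂}` from these.

HONEST LABEL: HC_CM is proved only modulo the 7 printed citations (2 remaining named inputs: hLiu418 = stmt-HodgeConjecture-24832, h413 = stmt-HodgeConjecture-24833) until rung 0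
closes; count-neutral helper.

## References
* [BernsteinZelevinsky1977] I. N. Bernstein, A. V. Zelevinsky, *Induced representations of reductive p-adic groups I*, Ann. Sci. ÉNS 10 (1977), §5.
* [WeilBNT1967] A. Weil, *Basic Number Theory* (1967), Chap. I §2, Th. 3 Cor. 3.
-/

set_option autoImplicit false
set_option linter.dupNamespace false

noncomputable section

open Function Representation ValuativeRel MeasureTheory
open scoped MatrixGroups NNReal
open Literature.NumberTheory.Automorphic Literature.NumberTheory.Weil1964
open Literature.NumberTheory.GaloisRepresentations.IsNonarchimedeanLocalField
open Summit.HodgeConjecture.HodgeConjecture.Cruxes.H413.K2E3GL3BorelInducedJacquetQOpenCellSupport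
open Summit.HodgeConjecture.HodgeConjecture.Cruxes.H413.K2E3GL3BorelInducedJacquetQOpenCellAlgebra

namespace Summit.HodgeConjecture.HodgeConjecture.Cruxes.H413.K2E3GL3BorelInducedJacquetQOpenCellIntegrand

variable {F : Type} [Field F] [ValuativeRel F] [TopologicalSpace F] [IsNonarchimedeanLocalField F]

/-! ## §1 Smooth induced vectors are locally constant functions -/

section Continuity

variable {G : Type*} [Group G] [TopologicalSpace G] [IsTopologicalGroup G] (H : Subgroup G)
  {W : Type*} [AddCommGroup W] [Module ℂ W] [TopologicalSpace W] (σ : Representation ℂ ↥H W)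

/-- **A smooth vector of `Ind_H^G σ` is a locally constant, hence continuous, function `G → W`** (constant on `x₀·Stab(f)`). [cite: BernsteinZelevinsky1977, §2.1] -/
theorem continuous_toFun (f : SmoothInd H σ) : Continuous f.toFun := by
  refine continuous_iff_continuousAt.2 fun x₀ => ?_
  have hK : IsOpen (((smoothIndRep H σ).stabilizerSubgroup f : Subgroup G) : Set G) := isSmooth_smoothInd H σ f
  have hmem : {x : G | x₀⁻¹ * x ∈ (smoothIndRep H σ).stabilizerSubgroup f} ∈ nhds x₀ := by
    refine (hK.preimage (continuous_const.mul continuous_id)).mem_nhds ?_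
    show x₀⁻¹ * x₀ ∈ (smoothIndRep H σ).stabilizerSubgroup f
    rw [inv_mul_cancel]; exact Subgroup.one_mem _
  refine (continuousAt_const (y := f.toFun x₀)).congr (Filter.eventuallyEq_of_mem hmem fun x hx => ?_)
  have h := congrArg (fun φ : SmoothInd H σ => φ.toFun x₀) ((mem_stabilizerSubgroup _ _ _).1 hx)
  simp only [toFun_smoothIndRep_apply, mul_inv_cancel_left] at h
  exact h.symm

end Continuity

/-! ## §2 The cell integrand: continuity, compact support, integrability -/

section Integrand

variable (h02 : (0 : Fin 3) ≠ 2) (h12 : (1 : Fin 3) ≠ 2)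
  (σ' : Representation ℂ ↥(standardParabolicGL F (id : Fin 3 → Fin 3)) ℂ)
  (D : GL (Fin 2) F → GL (Fin 3) F)
  (hD : ∀ g : GL (Fin 2) F, ((D g : GL (Fin 3) F) : Matrix (Fin 3) (Fin 3) F) =
    !![(g : Matrix (Fin 2) (Fin 2) F) 0 0, (g : Matrix (Fin 2) (Fin 2) F) 0 1, 0;
       (g : Matrix (Fin 2) (Fin 2) F) 1 0, (g : Matrix (Fin 2) (Fin 2) F) 1 1, 0;
       0, 0, 1])

/-- **The cell integrand `v ↦ f(w·n(v)·x)` is continuous** (any `x`). [cite: BernsteinZelevinsky1977, §5] -/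
theorem continuous_cellFn (f : SmoothInd (standardParabolicGL F (id : Fin 3 → Fin 3)) σ') (x : GL (Fin 3) F) :
    Continuous fun v : Fin 2 → F =>
      f.toFun (permGL (Equiv.swap (1 : Fin 3) 2 * Equiv.swap 0 1) * (transvectionUnit 0 2 h02 (v 0) * transvectionUnit 1 2 h12 (v 1)) * x) := by
  haveI : IsTopologicalRing F := inferInstance
  exact (continuous_toFun _ σ' f).comp ((continuous_const.mul (continuous_uP h02 h12)).mul continuous_const)

include hD in
/-- **The cell integrand of a function vanishing on `Z` is supported in a ball**: there is `R` with `f(w·n(v)·ι̂(g)) = 0` whenever `max(|v₀|,|v₁|) > R`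
(★ part 1 `toFun_eq_zero_of_entry_large` at the cell point, whose minor is `det g ≠ 0` and whose block is `g`, ★ part 2a). [cite: BernsteinZelevinsky1977, §5 (Thm. 5.2)] -/
theorem exists_cellFn_eq_zero_of_lt {f : SmoothInd (standardParabolicGL F (id : Fin 3 → Fin 3)) σ'}
    (hf : f ∈ vanishingOn (standardParabolicGL F (id : Fin 3 → Fin 3)) σ'
      {g : GL (Fin 3) F | (g : Matrix (Fin 3) (Fin 3) F) 1 0 * (g : Matrix (Fin 3) (Fin 3) F) 2 1 - (g : Matrix (Fin 3) (Fin 3) F) 1 1 * (g : Matrix (Fin 3) (Fin 3) F) 2 0 = 0})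
    (g : GL (Fin 2) F) :
    ∃ R : ValueGroupWithZero F, ∀ v : Fin 2 → F, R < max (valuation F (v 0)) (valuation F (v 1)) →
      f.toFun (permGL (Equiv.swap (1 : Fin 3) 2 * Equiv.swap 0 1) * (transvectionUnit 0 2 h02 (v 0) * transvectionUnit 1 2 h12 (v 1)) * D g) = 0 := by
  obtain ⟨ε, hα, hβ⟩ := exists_transvections_fix σ' f
  -- `M = ‖g‖`, `R = M / ε`
  set M : ValueGroupWithZero F := max (max (valuation F ((g : Matrix (Fin 2) (Fin 2) F) 0 0)) (valuation F ((g : Matrix (Fin 2) (Fin 2) F) 0 1)))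
    (max (valuation F ((g : Matrix (Fin 2) (Fin 2) F) 1 0)) (valuation F ((g : Matrix (Fin 2) (Fin 2) F) 1 1))) with hM
  refine ⟨M * (ε : ValueGroupWithZero F)⁻¹, fun v hv => ?_⟩
  have hdet : (g : Matrix (Fin 2) (Fin 2) F).det ≠ 0 := by
    have := g.isUnit.map Matrix.detMonoidHom
    simpa [isUnit_iff_ne_zero] using this
  -- part 1 fixes `t₂₀(α)`, `t₂₁(β)` stated with `by decide` proofs of `2 ≠ 0`, `2 ≠ 1`; these are the same terms
  refine toFun_eq_zero_of_entry_large σ' hf hα hβ _ ?_ ?_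
  · rw [minor_cellPoint h02 h12 D hD]; exact hdet
  · simp only [cellPoint_apply h02 h12 D hD]
    simp only [Matrix.of_apply, Matrix.cons_val', Matrix.cons_val_zero, Matrix.cons_val_one, Matrix.cons_val_two, Matrix.empty_val',
      Matrix.cons_val_fin_one, Matrix.head_cons, Matrix.tail_cons, Matrix.head_fin_const]
    change M < (ε : ValueGroupWithZero F) * max (valuation F (v 0)) (valuation F (v 1))
    have hε : (0 : ValueGroupWithZero F) < ε := lt_of_le_of_ne zero_le ε.ne_zero.symm
    calc M = M * (ε : ValueGroupWithZero F)⁻¹ * ε := by rw [mul_assoc, inv_mul_cancel₀ ε.ne_zero, mul_one]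
      _ < max (valuation F (v 0)) (valuation F (v 1)) * ε := mul_lt_mul_of_pos_right hv hε
      _ = (ε : ValueGroupWithZero F) * max (valuation F (v 0)) (valuation F (v 1)) := mul_comm _ _

include hD in
/-- **The cell integrand of a function vanishing on `Z` has compact support** (inside the compact ball `{max(|v₀|,|v₁|) ≤ R}`). [cite: BernsteinZelevinsky1977, §5] -/
theorem hasCompactSupport_cellFn {f : SmoothInd (standardParabolicGL F (id : Fin 3 → Fin 3)) σ'}
    (hf : f ∈ vanishingOn (standardParabolicGL F (id : Fin 3 → Fin 3)) σ'
      {g : GL (Fin 3) F | (g : Matrix (Fin 3) (Fin 3) F) 1 0 * (g : Matrix (Fin 3) (Fin 3) F) 2 1 - (g : Matrix (Fin 3) (Fin 3) F) 1 1 * (g : Matrix (Fin 3) (Fin 3) F) 2 0 = 0})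
    (g : GL (Fin 2) F) :
    HasCompactSupport fun v : Fin 2 → F =>
      f.toFun (permGL (Equiv.swap (1 : Fin 3) 2 * Equiv.swap 0 1) * (transvectionUnit 0 2 h02 (v 0) * transvectionUnit 1 2 h12 (v 1)) * D g) := by
  haveI : T2Space F := (isLocalField F).toT2Space
  obtain ⟨R, hR⟩ := exists_cellFn_eq_zero_of_lt h02 h12 σ' D hD hf g
  refine HasCompactSupport.intro (K := Set.pi Set.univ fun _ : Fin 2 => {x : F | valuation F x ≤ R})
    (isCompact_univ_pi fun _ => IsNonarchimedeanLocalField.isCompact_closedBall F R) fun v hv => hR v ?_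
  simp only [Set.mem_univ_pi, Set.mem_setOf_eq, not_forall, not_le] at hv
  obtain ⟨i, hi⟩ := hv
  fin_cases i
  · exact lt_of_lt_of_le hi (le_max_left _ _)
  · exact lt_of_lt_of_le hi (le_max_right _ _)

variable [MeasurableSpace F] [BorelSpace F] (μ : Measure F) [μ.IsAddHaarMeasure]

include hD in
/-- **The cell integrand of a function vanishing on `Z` is integrable** for `μ ⊗ μ`. [cite: BernsteinZelevinsky1977, §5] -/
theorem integrable_cellFn {f : SmoothInd (standardParabolicGL F (id : Fin 3 → Fin 3)) σ'}
    (hf : f ∈ vanishingOn (standardParabolicGL F (id : Fin 3 → Fin 3)) σ'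
      {g : GL (Fin 3) F | (g : Matrix (Fin 3) (Fin 3) F) 1 0 * (g : Matrix (Fin 3) (Fin 3) F) 2 1 - (g : Matrix (Fin 3) (Fin 3) F) 1 1 * (g : Matrix (Fin 3) (Fin 3) F) 2 0 = 0})
    (g : GL (Fin 2) F) :
    Integrable (fun v : Fin 2 → F =>
      f.toFun (permGL (Equiv.swap (1 : Fin 3) 2 * Equiv.swap 0 1) * (transvectionUnit 0 2 h02 (v 0) * transvectionUnit 1 2 h12 (v 1)) * D g))
      (Measure.pi fun _ : Fin 2 => μ) := by
  haveI : T2Space F := (isLocalField F).toT2Space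
  haveI : LocallyCompactSpace F := (isLocalField F).toLocallyCompactSpace
  haveI : SecondCountableTopology F := secondCountableTopology_localField F
  exact (continuous_cellFn h02 h12 σ' f (D g)).integrable_of_hasCompactSupport (hasCompactSupport_cellFn h02 h12 σ' D hD hf g)

/-! ## §3 Translation and substitution -/

include hD in
/-- **TRANSLATION**: `∫ f(w·n(v)·ι̂(g)·n(a,b)) dv = ∫ f(w·n(v)·ι̂(g)) dv` (`ι̂(g) n(a,b) = n(g(a,b)) ι̂(g)` and `μ ⊗ μ` is translation invariant). [cite: BernsteinZelevinsky1977, §5] -/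
theorem integral_cellFn_mul_uP (f : SmoothInd (standardParabolicGL F (id : Fin 3 → Fin 3)) σ') (g : GL (Fin 2) F) (a b : F) :
    ∫ v : Fin 2 → F, f.toFun (permGL (Equiv.swap (1 : Fin 3) 2 * Equiv.swap 0 1) * (transvectionUnit 0 2 h02 (v 0) * transvectionUnit 1 2 h12 (v 1)) * D g *
        (transvectionUnit 0 2 h02 a * transvectionUnit 1 2 h12 b)) ∂(Measure.pi fun _ : Fin 2 => μ) =
      ∫ v : Fin 2 → F, f.toFun (permGL (Equiv.swap (1 : Fin 3) 2 * Equiv.swap 0 1) * (transvectionUnit 0 2 h02 (v 0) * transvectionUnit 1 2 h12 (v 1)) * D g)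
        ∂(Measure.pi fun _ : Fin 2 => μ) := by
  -- `u := g (a,b)`, so that `n(u)·ι̂(g) = ι̂(g)·n(a,b)`
  set u : Fin 2 → F := ((g : GL (Fin 2) F) : Matrix (Fin 2) (Fin 2) F).mulVec ![a, b] with hu
  have hgu : ((g⁻¹ : GL (Fin 2) F) : Matrix (Fin 2) (Fin 2) F).mulVec u = ![a, b] := by
    rw [hu, Matrix.mulVec_mulVec, ← Units.val_mul, inv_mul_cancel, Units.val_one, Matrix.one_mulVec]
  have key : ∀ v : Fin 2 → F,
      permGL (Equiv.swap (1 : Fin 3) 2 * Equiv.swap 0 1) * (transvectionUnit 0 2 h02 (v 0) * transvectionUnit 1 2 h12 (v 1)) * D g *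
          (transvectionUnit 0 2 h02 a * transvectionUnit 1 2 h12 b) =
        permGL (Equiv.swap (1 : Fin 3) 2 * Equiv.swap 0 1) * (transvectionUnit 0 2 h02 ((u + v) 0) * transvectionUnit 1 2 h12 ((u + v) 1)) * D g := by
    intro v
    have h1 : D g * (transvectionUnit 0 2 h02 a * transvectionUnit 1 2 h12 b) = (transvectionUnit 0 2 h02 (u 0) * transvectionUnit 1 2 h12 (u 1)) * D g := by
      rw [uP_mul_diag h02 h12 D hD u g, hgu]; rfl
    rw [show (u + v) 0 = v 0 + u 0 from add_comm _ _, show (u + v) 1 = v 1 + u 1 from add_comm _ _, uP_add h02 h12,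
      mul_assoc _ (D g), h1]
    simp only [mul_assoc]
  haveI : T2Space F := (isLocalField F).toT2Space
  haveI : LocallyCompactSpace F := (isLocalField F).toLocallyCompactSpace
  haveI : SecondCountableTopology F := secondCountableTopology_localField F
  haveI : SigmaFinite μ := by infer_instance
  simp_rw [key]
  exact integral_add_left_eq_self (μ := Measure.pi fun _ : Fin 2 => μ)
    (fun v : Fin 2 → F => f.toFun (permGL (Equiv.swap (1 : Fin 3) 2 * Equiv.swap 0 1) * (transvectionUnit 0 2 h02 (v 0) * transvectionUnit 1 2 h12 (v 1)) * D g)) u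

include hD in
/-- **SUBSTITUTION**: `∫ f(w·n(v)·ι̂(b)·x) dv = |det b| · ∫ f(w·ι̂(b)·n(v)·x) dv` for every `b ∈ GL₂(F)` and `x ∈ GL₃(F)` (`n(v) ι̂(b) = ι̂(b) n(b⁻¹ v)`, ★ `integral_comp_linearEquiv`
with `e = b⁻¹`, `|det b⁻¹|⁻¹ = |det b|`). [cite: WeilBNT1967, Chap. I §2, Th. 3 Cor. 3] [cite: BernsteinZelevinsky1977, §5] -/
theorem integral_cellFn_diag_mul (f : SmoothInd (standardParabolicGL F (id : Fin 3 → Fin 3)) σ') (b : GL (Fin 2) F) (x : GL (Fin 3) F) :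
    ∫ v : Fin 2 → F, f.toFun (permGL (Equiv.swap (1 : Fin 3) 2 * Equiv.swap 0 1) * (transvectionUnit 0 2 h02 (v 0) * transvectionUnit 1 2 h12 (v 1)) * D b * x)
        ∂(Measure.pi fun _ : Fin 2 => μ) =
      ((normAbs F ((b : Matrix (Fin 2) (Fin 2) F).det) : ℝ) : ℂ) *
        ∫ v : Fin 2 → F, f.toFun (permGL (Equiv.swap (1 : Fin 3) 2 * Equiv.swap 0 1) * D b * (transvectionUnit 0 2 h02 (v 0) * transvectionUnit 1 2 h12 (v 1)) * x)
          ∂(Measure.pi fun _ : Fin 2 => μ) := by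
  -- the linear automorphism `e = b⁻¹` of `F²`
  let e : (Fin 2 → F) ≃ₗ[F] (Fin 2 → F) :=
    { toLinearMap := Matrix.toLin' ((b⁻¹ : GL (Fin 2) F) : Matrix (Fin 2) (Fin 2) F)
      invFun := Matrix.toLin' ((b : GL (Fin 2) F) : Matrix (Fin 2) (Fin 2) F)
      left_inv := fun v => by
        simp only [LinearMap.toFun_eq_coe, Matrix.toLin'_apply, Matrix.mulVec_mulVec, ← Units.val_mul, mul_inv_cancel, Units.val_one, Matrix.one_mulVec]
      right_inv := fun v => by
        simp only [LinearMap.toFun_eq_coe, Matrix.toLin'_apply, Matrix.mulVec_mulVec, ← Units.val_mul, inv_mul_cancel, Units.val_one, Matrix.one_mulVec] }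
  have he : ∀ v, e v = ((b⁻¹ : GL (Fin 2) F) : Matrix (Fin 2) (Fin 2) F).mulVec v := fun v => Matrix.toLin'_apply _ _
  have hdet : LinearMap.det (e : (Fin 2 → F) →ₗ[F] (Fin 2 → F)) = ((b⁻¹ : GL (Fin 2) F) : Matrix (Fin 2) (Fin 2) F).det := LinearMap.det_toLin' _
  -- rewrite the integrand as `φ (e v)` with `φ v = f(w ι̂(b) n(v) x)`
  have key : ∀ v : Fin 2 → F,
      permGL (Equiv.swap (1 : Fin 3) 2 * Equiv.swap 0 1) * (transvectionUnit 0 2 h02 (v 0) * transvectionUnit 1 2 h12 (v 1)) * D b * x =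
        permGL (Equiv.swap (1 : Fin 3) 2 * Equiv.swap 0 1) * D b * (transvectionUnit 0 2 h02 ((e v) 0) * transvectionUnit 1 2 h12 ((e v) 1)) * x := by
    intro v
    rw [he, mul_assoc (permGL _) _ (D b), uP_mul_diag h02 h12 D hD v b, ← mul_assoc]
  haveI : T2Space F := (isLocalField F).toT2Space
  haveI : LocallyCompactSpace F := (isLocalField F).toLocallyCompactSpace
  haveI : SecondCountableTopology F := secondCountableTopology_localField F
  simp_rw [key]
  rw [integral_comp_linearEquiv μ e (fun u : Fin 2 → F =>
    f.toFun (permGL (Equiv.swap (1 : Fin 3) 2 * Equiv.swap 0 1) * D b * (transvectionUnit 0 2 h02 (u 0) * transvectionUnit 1 2 h12 (u 1)) * x)), hdet]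
  -- `|det b⁻¹|⁻¹ = |det b|`
  have hbdet : ((b⁻¹ : GL (Fin 2) F) : Matrix (Fin 2) (Fin 2) F).det = ((b : Matrix (Fin 2) (Fin 2) F).det)⁻¹ := by
    rw [Matrix.coe_units_inv, Matrix.det_nonsing_inv, Ring.inverse_eq_inv']
  rw [hbdet]
  simp only [inv_inv, Complex.real_smul]

end Integrand

end Summit.HodgeConjecture.HodgeConjecture.Cruxes.H413.K2E3GL3BorelInducedJacquetQOpenCellIntegrand

end
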